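import Mathlib
import Summits.MatrixMultiplication.MatrixMultiplication.Theorems.ThinBlockAlphaThinPackingsOrbitCriterion
import Summits.MatrixMultiplication.MatrixMultiplication.Theorems.ThinBlockAlphaThinPackingsOrbitGainCap

set_option linter.dupNamespace false

/-!
# Two corollaries of the Fourier cap on orbit designs — stubs `stub_freeActionCap`, `stub_heartNeedsStabilisers`

Crux `stmt-MatrixMultiplication-10595` (`Theses.ThinBlockAlpha.ThinPackings`), line `Ideator4Sketch`
(card `automorphism-orbit-twisted-templates`), lead a3, 2026-08-16.

* `stub_freeActionCap` (F8): if `Γ` acts FREELY on the nontrivial characters of `H` (tori `F_{q^d}^×`, Singer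
  cycles, Frobenius complements), an orbit design has `|Γ|⁴(|A||B||C|)² ≤ 4|H|³` — gain `≤ 2√|H|/|Γ|`.
* `stub_heartNeedsStabilisers` (F9): in the heart's own parameters (`⟨N, M, N⟩`, `N^a ≤ M`,
  `|H| ≤ |Γ| N^{2+η}`), stabilisers of size `≤ S` force `N^{3a − 2 − 4η} ≤ 4 S` — for `a > 2/3` the group must
  fix nontrivial characters massively.
Both are bookkeeping over the landed `stub_orbitGainCap` (F7) and the TPP volume bound `N²M ≤ |H|`.
-/

namespace Summit.MatrixMultiplication.MatrixMultiplication.Theorems.ThinPackings.Orbit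

open Finset


section Volume

variable {H : Type} [AddCommGroup H] [Fintype H]

/-- TPP volume bound: `(a, b, c) ↦ a + b + c` is injective on `A × B × C`, so `|A||B||C| ≤ |H|`. -/
theorem card_mul_card_mul_card_le_card_of_templateTPP (A B C : Finset H) (hT : TemplateTPP A B C) :
    A.card * B.card * C.card ≤ Fintype.card H := by
  have hcard : ((A ×ˢ B) ×ˢ C).card = A.card * B.card * C.card := by
    rw [card_product, card_product]
  rw [← hcard, ← Finset.card_univ (α := H)]
  refine card_le_card_of_injOn (fun p => p.1.1 + p.1.2 + p.2) (fun _ _ => mem_coe.2 (mem_univ _)) ?_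
  rintro ⟨⟨a, b⟩, c⟩ hp ⟨⟨a', b'⟩, c'⟩ hq hpq
  simp only [mem_coe, mem_product] at hp hq
  simp only at hpq
  have hrel : (a' - a) + (b' - b) + (c' - c) = 0 := by
    have e : (a' - a) + (b' - b) + (c' - c) = (a' + b' + c') - (a + b + c) := by abel
    rw [e, hpq, sub_self]
  obtain ⟨rfl, rfl, rfl⟩ := hT a hp.1.1 a' hq.1.1 b hp.1.2 b' hq.1.2 c hp.2 c' hq.2 hrel
  rfl

end Volume

/-- **Registered stub `stub_freeActionCap`** (F8): free actions on the nontrivial characters give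
no gain. [new] -/
theorem stub_freeActionCap : ∀ {Γ H : Type} [Group Γ] [Fintype Γ] [AddCommGroup H] [Fintype H] [DecidableEq H] [DistribMulAction Γ H] (A B C : Finset H), TemplateTPP A B C → TwistedSumFree Γ A B C → (∀ ψ : AddChar H ℂ, ψ ≠ 0 → ∀ g : Γ, ψ.compAddMonoidHom (DistribSMul.toAddMonoidHom H g) = ψ → g = 1) → 2 * Fintype.card H ≤ Fintype.card Γ ^ 2 * (A.card * B.card * C.card) → Fintype.card Γ ^ 4 * (A.card * B.card * C.card) ^ 2 ≤ 4 * Fintype.card H ^ 3 := by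
  intro Γ H _ _ _ _ _ _ A B C hT hTw hfree hbig
  have h := stub_orbitGainCap A B C 1 hT hTw Nat.one_pos (fun ψ hψ T hTψ => ?_) hbig
  · simpa using h
  · refine Finset.card_le_one.2 fun g hg g' hg' => ?_
    rw [hfree ψ hψ g (hTψ g hg), hfree ψ hψ g' (hTψ g' hg')]

/-- **Registered stub `stub_heartNeedsStabilisers`** (F9): a witness of the heart at `(a, η)` whose
nontrivial characters have stabilisers of size `≤ S` has `N^{3a−2−4η} ≤ 4S`. [new] -/
theorem stub_heartNeedsStabilisers : ∀ {Γ H : Type} [Group Γ] [Fintype Γ] [AddCommGroup H] [Fintype H] [DecidableEq H] [DistribMulAction Γ H] (A B C : Finset H) (S N M : ℕ) (a η : ℝ), TemplateTPP A B C → TwistedSumFree Γ A B C → 0 < S → (∀ ψ : AddChar H ℂ, ψ ≠ 0 → ∀ T : Finset Γ, (∀ g ∈ T, ψ.compAddMonoidHom (DistribSMul.toAddMonoidHom H g) = ψ) → T.card ≤ S) → A.card = N → B.card = M → C.card = N → 2 ≤ N → 0 ≤ a → (N : ℝ) ^ a ≤ M → 0 ≤ η → (Fintype.card H : ℝ) ≤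 Fintype.card Γ * (N : ℝ) ^ (2 + η) → 2 * Fintype.card H ≤ Fintype.card Γ ^ 2 * (A.card * B.card * C.card) → (N : ℝ) ^ (3 * a - 2 - 4 * η) ≤ 4 * S := by
  intro Γ H _ _ _ _ _ _ A B C S N M a η hT hTw hS hStab hA hB hC hN ha hM hη hH hbig
  have hcap := stub_orbitGainCap A B C S hT hTw hS hStab hbig
  have hvol := card_mul_card_mul_card_le_card_of_templateTPP A B C hT
  rw [hA, hB, hC] at hcap hvol hbig
  -- real casts
  have hN1 : (1 : ℝ) < N := by exact_mod_cast (by omega : 1 < N)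
  have hNpos : (0 : ℝ) < N := by linarith
  set γ : ℝ := ((Fintype.card Γ : ℕ) : ℝ) with hγ
  set h : ℝ := ((Fintype.card H : ℕ) : ℝ) with hh
  have hhpos : 0 < h := by rw [hh]; exact_mod_cast Fintype.card_pos
  have hV : (N : ℝ) * M * N ≤ h := by rw [hh]; exact_mod_cast hvol
  have hcapr : γ ^ 4 * ((N : ℝ) * M * N) ^ 2 ≤ 4 * S * h ^ 3 := by
    rw [hγ, hh]; exact_mod_cast hcap
  clear_value γ h
  have hM1 : (1 : ℝ) ≤ M := (Real.one_le_rpow hN1.le ha).trans hM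
  have hMpos : (0 : ℝ) < M := by linarith
  set P : ℝ := (N : ℝ) ^ (2 + η) with hP
  have hPpos : 0 < P := by rw [hP]; positivity
  have hγpos : 0 < γ := by
    have : 0 < γ * P := lt_of_lt_of_le hhpos hH
    exact (pos_iff_pos_of_mul_pos this).2 hPpos
  -- from `h ≤ γ P` and the cap: `γ V² ≤ 4 S P³`
  set V : ℝ := (N : ℝ) * M * N with hVdef
  have hVpos : 0 < V := by rw [hVdef]; positivity
  have h1 : γ * V ^ 2 ≤ 4 * S * P ^ 3 := by
    have h3 : h ^ 3 ≤ (γ * P) ^ 3 := by gcongr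
    have : γ ^ 4 * V ^ 2 ≤ 4 * S * (γ * P) ^ 3 := hcapr.trans (by gcongr)
    have e : 4 * S * (γ * P) ^ 3 = (4 * S * P ^ 3) * γ ^ 3 := by ring
    rw [e] at this
    have hγ3 : 0 < γ ^ 3 := by positivity
    nlinarith [this, hγ3]
  -- and `V ≤ h ≤ γ P` gives `γ ≥ V / P`
  have h2 : V ≤ γ * P := hV.trans hH
  have h3 : V ^ 3 ≤ 4 * S * P ^ 4 := by
    have : V * V ^ 2 ≤ (γ * P) * V ^ 2 := by gcongr
    nlinarith [this, h1, hPpos]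
  -- `V³ = N⁶ M³ ≥ N^{6+3a}` and `P⁴ = N^{8+4η}`
  have hM3 : (N : ℝ) ^ (3 * a) ≤ M ^ 3 := by
    calc (N : ℝ) ^ (3 * a) = ((N : ℝ) ^ a) ^ 3 := by
          rw [mul_comm, Real.rpow_mul hNpos.le]; norm_cast
      _ ≤ M ^ 3 := by gcongr
  have hV3 : (N : ℝ) ^ (6 + 3 * a) ≤ V ^ 3 := by
    rw [Real.rpow_add hNpos, hVdef]
    have e : ((N : ℝ) * M * N) ^ 3 = (N : ℝ) ^ (6 : ℝ) * M ^ 3 := by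
      rw [show (6 : ℝ) = ((6 : ℕ) : ℝ) by norm_num, Real.rpow_natCast]; ring
    rw [e]; gcongr
  have hP4 : P ^ 4 = (N : ℝ) ^ (8 + 4 * η) := by
    rw [hP, ← Real.rpow_natCast, ← Real.rpow_mul hNpos.le]; norm_num; ring_nf
  -- conclude: `N^{6+3a} ≤ 4 S N^{8+4η}`
  have h4 : (N : ℝ) ^ (6 + 3 * a) ≤ 4 * S * (N : ℝ) ^ (8 + 4 * η) := by
    rw [← hP4]; exact hV3.trans h3
  have hsplit : (N : ℝ) ^ (3 * a - 2 - 4 * η) = (N : ℝ) ^ (6 + 3 * a) * ((N : ℝ) ^ (8 + 4 * η))⁻¹ := by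
    rw [← Real.rpow_neg hNpos.le, ← Real.rpow_add hNpos]; ring_nf
  rw [hsplit]
  have hQpos : 0 < (N : ℝ) ^ (8 + 4 * η) := by positivity
  rw [mul_inv_le_iff₀ hQpos]
  linarith
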